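import Mathlib

/-!
# Stub `stub_partialMapTwist` (B2b) of crux `FermionicNormalForm`, line `registered`

Crux `Summit.ValiantsHypothesis.ValiantsHypothesis.Theses.TwistedDetRank.FermionicNormalForm`
(item `stmt-ValiantsHypothesis-6283`), line `registered`
(= `Cruxes/FermionicNormalForm/Lines/birth.lean`), stub `stub_partialMapTwist` (B2b).

The elementary partial-map twist (Marcus–Minc 1961; Bürgisser 2000, §7.1): for a partial map `p`
on `S ⊆ Fin n` moving every point of `S`, the matrix `E` whose column `j` is `e_{p j}` for `j ∈ S`
and the all-ones column with `u` on the diagonal for `j ∉ S` satisfies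
`∏ j, E (σ j) j = u ^ c₁(σ) · [σ j = p j for all j ∈ S]`, where `c₁(σ) = #{j : σ j = j}` is the
number of fixed points of `σ`: on the columns `j ∈ S` the product is the indicator that `σ` extends
`p`, and on the columns `j ∉ S` it is `u ^ #{j ∉ S : σ j = j}`, which is `u ^ c₁(σ)` whenever `σ`
extends `p` (no point of `S` is then fixed, since `σ j = p j ≠ j`).
-/

-- single-conjunct layout: Sub = Summit, duplicated namespace component intended
set_option linter.dupNamespace false

namespace Summit.ValiantsHypothesis.ValiantsHypothesis.Theorems.TwistedDetRankFermionicNormalForm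

/-- **Partial-map twist** (B2b). For a partial map `p` on `S ⊆ Fin n` with `p i ≠ i` for `i ∈ S`
there is a matrix `E` (column `j` equal to `e_{p j}` for `j ∈ S`, and to the all-ones column with
`u` in the diagonal position for `j ∉ S`) such that, for every permutation `σ`,
`∏ j, E (σ j) j = u ^ #{j | σ j = j} * [∀ j ∈ S, σ j = p j]`. -/
theorem stub_partialMapTwist :
    ∀ (n : ℕ) (u : ℂ) (S : Finset (Fin n)) (p : Fin n → Fin n), (∀ i ∈ S, p i ≠ i) →
      ∃ E : Matrix (Fin n) (Fin n) ℂ, ∀ σ : Equiv.Perm (Fin n),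
        u ^ (Finset.univ.filter fun i => σ i = i).card *
            (if ∀ i ∈ S, σ i = p i then 1 else 0) = ∏ i, E (σ i) i := by
  intro n u S p hp
  refine ⟨fun i j => if j ∈ S then (if i = p j then 1 else 0) else (if i = j then u else 1),
    fun σ => Eq.symm ?_⟩
  calc ∏ j, (if j ∈ S then (if σ j = p j then (1 : ℂ) else 0) else (if σ j = j then u else 1))
      = (∏ j ∈ S, if σ j = p j then (1 : ℂ) else 0) * ∏ j ∈ Sᶜ, if σ j = j then u else 1 := by
        rw [← Finset.prod_mul_prod_compl S]
        exact congrArg₂ (· * ·) (Finset.prod_congr rfl fun j hj => if_pos hj)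
          (Finset.prod_congr rfl fun j hj => if_neg (Finset.mem_compl.mp hj))
    _ = u ^ (Finset.univ.filter fun i => σ i = i).card *
          (if ∀ i ∈ S, σ i = p i then 1 else 0) := by
        rw [Finset.prod_boole, Finset.prod_ite, Finset.prod_const, Finset.prod_const_one, mul_one]
        by_cases h : ∀ j ∈ S, σ j = p j
        · simp only [if_pos h, one_mul, mul_one]
          congr 2
          ext j
          simp only [Finset.mem_filter, Finset.mem_univ, true_and, Finset.mem_compl]
          exact ⟨fun hj => hj.2, fun hj => ⟨fun hjS => hp j hjS ((h j hjS).symm.trans hj), hj⟩⟩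
        · simp only [if_neg h, zero_mul, mul_zero]

end Summit.ValiantsHypothesis.ValiantsHypothesis.Theorems.TwistedDetRankFermionicNormalForm
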